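import Literature.FieldTheory.FiniteFields.SymbolicDivisibility
import HarnessLib

/-!
# The least common symbolic (left) multiple of two `q`-polynomials
# (Goss, *Basic Structures*, § 1.6, Corollary 1.6.3; Ore 1933; Lidl–Niederreiter, Exercise 3.65)

Topic `Literature/FieldTheory/FiniteFields`; namespace `Literature.FieldTheory.FiniteFields.LeastCommonSymbolicMultiple`.
Lane `lit-hodgefound` (Track 2 foundations library), seat p01, generation 30, row g30-#22 (sequel of g30-#16/#18).
THEOREMS ONLY (no definition, no named fact, no instance, no notation; D-0014/D-0026, net Literature debt 0).

## Sources, VERBATIM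

D. Goss, *Basic Structures of Function Field Arithmetic* [Goss1996], § 1.6 (held scan, PDF p. 23):
«**Corollary 1.6.3.** Every left ideal of `k{τ}` is principal.» — applied here to the left ideal of common left
multiples `k{τ}A ∩ k{τ}B`, whose monic generator is Ore's least common (left) multiple [Ore1933, Ch. 1].
R. Lidl, H. Niederreiter, *Finite Fields* [LidlNiederreiter1996], Exercise 3.65 (PDF p. 134): «[…] but that their
least common multiple need not necessarily be a q-polynomial.» (the tree's g30-#9 `exercise_3_65_lcm_not_qPolynomial`)
— so the ORDINARY lcm is the wrong object; the least q-polynomial common multiple below is the right one, and the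
ordinary lcm divides it.

## Dictionary and set-up

`k = 𝔽_q` (`q = Fintype.card k`); `K ⊇ 𝔽_q` any field (`[Algebra k K]`); native q-polynomials; by g30-#18
`dvd_iff_exists_eq_comp`, for q-polynomials «`M` right-divides `N` symbolically (`N = U ⊗ M`)» is ordinary
divisibility `M ∣ N`, so «common left multiple of `A` and `B` in `K{τ}`» = q-polynomial `N` with `A ∣ N` and `B ∣ N`.

## What is proved (theorems only)

* `exists_ne_zero_qPolynomial_common_multiple` (a nonzero q-polynomial common multiple exists — g30-#5, Ore's
  theorem, applied to `A·B`).
* **`exists_least_common_multiple`** — the LEAST COMMON SYMBOLIC MULTIPLE: for nonzero q-polynomials `A`, `B` there is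
  a nonzero q-polynomial common multiple `M` that divides every q-polynomial common multiple (the generator of the
  left ideal of common left multiples; minimal degree + right division g30-#16: the remainder of a common multiple
  is a common multiple of smaller degree).
* `associated_of_least` (uniqueness up to a unit), `lcm_dvd_of_least` (the ordinary lcm divides it).

## References
* [Goss1996] D. Goss, *Basic Structures of Function Field Arithmetic*, § 1.6 Corollary 1.6.3 (PDF p. 23).
* [Ore1933] O. Ore, *On a special class of polynomials*, Trans. AMS 35 (1933) 559–584, Ch. 1 § 3 (least common
  multiple / union of `p`-polynomials).
* [LidlNiederreiter1996] Exercise 3.65 (p. 134).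
* Tree: g30-#16 `SymbolicDivision` (`exists_eq_comp_add`), g30-#18 `SymbolicDivisibility`
  (`dvd_comp_of_coeff_zero_eq_zero`, `dvd_iff_exists_eq_comp`), g30-#5 `AdditiveMultiple` (`exists_qPolynomial_dvd`).
* Mathlib: `Polynomial.eq_zero_of_dvd_of_degree_lt`, `associated_of_dvd_dvd`, `lcm_dvd`.
-/

open Polynomial
open scoped BigOperators

namespace Literature.FieldTheory.FiniteFields.LeastCommonSymbolicMultiple

open Literature.FieldTheory.FiniteFields.SymbolicDivision (exists_eq_comp_add)
open Literature.FieldTheory.FiniteFields.SymbolicDivisibility (dvd_comp_of_coeff_zero_eq_zero)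
open Literature.FieldTheory.FiniteFields.AdditiveMultiple (exists_qPolynomial_dvd)

universe u v

variable {k : Type u} [Field k] [Fintype k]
variable {K : Type v} [Field K] [Algebra k K]

omit [Algebra k K] in
/-- Two nonzero polynomials have a NONZERO q-polynomial common multiple (Ore's theorem, g30-#5, applied to `A·B`).
[cite: Goss1996, Theorem 1.4.1] [cite: Ore1933, Ch. 1] -/
theorem exists_ne_zero_qPolynomial_common_multiple {A B : K[X]} (hA0 : A ≠ 0) (hB0 : B ≠ 0) :
    ∃ N : K[X], N ≠ 0 ∧ (∀ n, (∀ i, n ≠ Fintype.card k ^ i) → N.coeff n = 0) ∧ A ∣ N ∧ B ∣ N := by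
  obtain ⟨N, hN0, hdvd, hNq, -⟩ := exists_qPolynomial_dvd (mul_ne_zero hA0 hB0) (q := Fintype.card k)
    Fintype.one_lt_card
  refine ⟨N, hN0, fun n hn => ?_, (dvd_mul_right A B).trans hdvd, (dvd_mul_left B A).trans hdvd⟩
  by_contra h
  obtain ⟨j, hj⟩ := hNq n h
  exact hn j hj

/-- **The least common symbolic multiple** (Goss Corollary 1.6.3 for the left ideal of common left multiples; Ore's
least common multiple): for nonzero `A`, `B ∈ K[x]` (in particular nonzero q-polynomials) over any `K ⊇ 𝔽_q`
there is a nonzero q-polynomial common multiple `M` of `A` and `B` which divides — equivalently (g30-#18) symbolically right-divides — every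
q-polynomial common multiple `N` (right division `N = Q ⊗ M + R`: `R` is again a q-polynomial common multiple, of
degree `< deg M`, hence `0` by minimality). [cite: Goss1996, Corollary 1.6.3] [cite: Ore1933, Ch. 1 §3] -/
theorem exists_least_common_multiple {A B : K[X]} (hA0 : A ≠ 0) (hB0 : B ≠ 0) :
    ∃ M : K[X], (∀ n, (∀ i, n ≠ Fintype.card k ^ i) → M.coeff n = 0) ∧ M ≠ 0 ∧ A ∣ M ∧ B ∣ M ∧
      ∀ N : K[X], (∀ n, (∀ i, n ≠ Fintype.card k ^ i) → N.coeff n = 0) → A ∣ N → B ∣ N → M ∣ N := by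
  classical
  have hex : ∃ d : ℕ, ∃ M : K[X], M ≠ 0 ∧ (∀ n, (∀ i, n ≠ Fintype.card k ^ i) → M.coeff n = 0) ∧ A ∣ M ∧ B ∣ M ∧
      M.natDegree = d := by
    obtain ⟨N, hN0, hNq, hAN, hBN⟩ := exists_ne_zero_qPolynomial_common_multiple (k := k) hA0 hB0
    exact ⟨N.natDegree, N, hN0, hNq, hAN, hBN, rfl⟩
  obtain ⟨M, hM0, hMq, hAM, hBM, hMd⟩ := Nat.find_spec hex
  refine ⟨M, hMq, hM0, hAM, hBM, fun N hNq hAN hBN => ?_⟩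
  -- right division of `N` by `M`
  obtain ⟨Q, R, hQ, hR, hNQR, hRdeg⟩ := exists_eq_comp_add hNq hMq hM0
  have hQM : M ∣ Q.comp M := dvd_comp_of_coeff_zero_eq_zero hQ M
  have hRN : R = N - Q.comp M := by rw [hNQR, add_sub_cancel_left]
  have hAR : A ∣ R := hRN ▸ dvd_sub hAN (hAM.trans hQM)
  have hBR : B ∣ R := hRN ▸ dvd_sub hBN (hBM.trans hQM)
  by_cases hR0 : R = 0
  · rw [hNQR, hR0, add_zero]
    exact hQM
  · -- `R` is a nonzero q-polynomial common multiple of smaller degree: contradiction with minimality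
    exfalso
    have hle : Nat.find hex ≤ R.natDegree := Nat.find_min' hex ⟨R, hR0, hR, hAR, hBR, rfl⟩
    have hlt : R.natDegree < M.natDegree := natDegree_lt_natDegree hR0 hRdeg
    omega

omit [Field k] [Fintype k] [Algebra k K] in
/-- Two least common symbolic multiples are associated (differ by a nonzero scalar).
[cite: Goss1996, Corollary 1.6.3 («monic generator»)] -/
theorem associated_of_least {A B M M' : K[X]} {P : K[X] → Prop} (hM : P M) (hM' : P M')
    (hAM : A ∣ M) (hBM : B ∣ M) (hAM' : A ∣ M') (hBM' : B ∣ M')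
    (hmin : ∀ N, P N → A ∣ N → B ∣ N → M ∣ N) (hmin' : ∀ N, P N → A ∣ N → B ∣ N → M' ∣ N) :
    Associated M M' :=
  associated_of_dvd_dvd (hmin M' hM' hAM' hBM') (hmin' M hM hAM hBM)

omit [Field k] [Fintype k] [Algebra k K] in
/-- The ordinary lcm divides the least common symbolic multiple (any common multiple).
[cite: LidlNiederreiter1996, Exercise 3.65] -/
theorem lcm_dvd_of_common [DecidableEq K] {A B M : K[X]} (hAM : A ∣ M) (hBM : B ∣ M) : lcm A B ∣ M :=
  lcm_dvd hAM hBM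

end Literature.FieldTheory.FiniteFields.LeastCommonSymbolicMultiple
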